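import Summits.ABC.IUTFork.Thm311RealArchHermitian
import Summits.ABC.IUTFork.Thm311RealDegreeFull
import HarnessLib

/-!
# [IUTchIII] Theorem 3.11 AS TYPED at the real instantiation WITH PRINT'S ARCHIMEDEAN INTEGRAL STRUCTURE and
# print's SINGLE-PLACE (Ind3)-images — holds outright

Record file (D-0012) of the abc-iut cell (Cor. 3.12 sub-crew, seat abc-iut-c312-1 — the typer of [IUTchIII]
Thm. 3.11 —, gen 5); TAKES NO SIDE on [IUTchIII] Cor. 3.12. Sequel to `Thm311RealDegreeFull` (same seat,
`Real.full_statement_Pr_LGP`: the premise of record `Thm311.FullSituation.Statement` holds with no hypothesis at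
the probability-weighted real instantiation — but with the TRIVIAL archimedean integral structure
`archPk := L.shellPk j ∞ = ⊤` and abc-iut-c312-12's ALL-PLACES pure-tensor (Ind3)-images `LogShells.tprodImages`).
abc-iut-w4-d001 (`Thm311RealArchShell`, `Thm311RealArchHermitian`, 02:3xZ) measured that reading against print:
PRINT's archimedean integral structure is the closed unit ball of the tensor-product Hermitian metric ([IUTchIII]
Prop. 3.2 (ii), kurims `paper:url-4b091feeb646` p. 98 l. −4 – p. 99 l. 5; on the real packet: `Real.archPkHermitian`),
and print's (Ind3) at `v_ℚ ∈ 𝕍^arc_ℚ` (Prop. 3.5 (ii) (b) p. 105) asks that ball to contain "the image, via the tensor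
product, over `|t| ∈ {0, …, j}`, of … both (1) the groups of units `(Ψ_cns(^{n,m}𝔉_≻)_{|t|})^×_v`, for `𝕍 ∋ v | v_ℚ`, and
(2) the closed balls of radius `π` inside `(Ψ_cns(^{n,m}𝔉_≻)_{|t|})^{gp}_v` …, for `𝕍 ∋ v | v_ℚ`" — pure tensors whose
every factor lives at ONE place `v` —, likewise (a) p. 104 at `v_ℚ ∈ 𝕍^non_ℚ` ("the submodules of Galois invariants …
of the groups of units `(Ψ_cns(^{n,m}𝔉_≻)_{|t|})^×_v`, for `𝕍 ∋ v | v_ℚ` and `|t| ∈ {0, …, j}`, via … the tensor product,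
over such `|t|`"); the all-places images are STRONGER THAN PRINT at `∞` and fit no proper archimedean structure
(`Real.tprodImages_shell_not_subset_archPkHermitian`, `Real.harch_iff_archPk_eq_univ`). w4-d001: "which clause the
real setting should carry is the typers'/referees' call". THIS FILE is the typer's answer, in the kernel:

* `LogShells.tprodSingleImages j v_ℚ S` — print's image shape: the pure tensors `⊗_{|t|} x_{|t|}` each of whose
  factors `x_{|t|}` is supported at a SINGLE place `v | v_ℚ` with `x_{|t|,v} ∈ S_v` (generic over any log-shell
  signature; `⊆ tprodImages S'` whenever `S ⊆ S' ∋ 0`, hence `⊆ L.shellPk` at finite `v_ℚ`);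
* `Real.tprodSingleImages_subset_archPkHermitian` — at `∞` such images with `S_w ⊆ 𝓘_w = {|·| ≤ π}` lie in
  print's Hermitian ball (w4-d001's `tprod_singlePlace_mem_archPkHermitian`);
* `Real.archPkPrint` — the archimedean integral-structure binder of c312-5's `MRData.ofShells` SET TO PRINT's
  `archPkHermitian` at `∞`;
* `Column.ind3_of_singleImages` — the typed (Ind3) (this seat's `Column.Ind3`, file C) HOLDS for every column whose
  unit-group images are the single-place images of abc-iut-w4-d029's honest log-link iterate images
  `Real.iterImage` and whose radius-`π` balls are the single-place images of the shells, against any coric data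
  whose integral structure contains `L.shellPk` at finite `v_ℚ` and `archPkHermitian` at `∞` (law `O_v ⊆ I_v`);
  `Real.partII_ofShells_singleImages_print` — hence this seat's typed Thm. 3.11 (ii) for the strictified lattice
  situation with `archPk := archPkPrint`;
* **`Real.full_statement_print_arch`** — `Thm311.FullSituation.Statement` with NO hypotheses at the
  probability-weighted real instantiation of `Real.full_statement_Pr_LGP` EXCEPT THAT (a)'s archimedean integral
  structure is print's Hermitian ball and the (Ind3)-images are print's single-place images (analytic logarithms;
  c312-5's `logShellsDH`; `summandPiecesPr`; LGP splitting monoids; (c) by fractional ideals; (iii) over any L6 glue).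

HONEST FRAMING: a measurement of the typing at the real carriers (ADJUDICATION-SPEC §3 (b)); it removes the two
caveats "trivial archimedean structure" / "stronger-than-print (Ind3) images" from the gen-5 measurement, nothing
more; no file of another seat is edited; `Cor312.Setting.Statement` is untouched. Sources read on the page (this
seat's render of `paper:url-4b091feeb646`): p. 104–105 (Prop. 3.5 (ii) (a)(b)), p. 156 ((Ind3)).
[claim: Mochizuki2012, status: disputed] typed ≠ proved; instantiated ≠ endorsed.
-/

noncomputable section

open Set Function NumberField IsDedekindDomain

namespace Summit.ABC.IUTFork.Thm311

open Literature.IUT.LogThetaLattice Literature.IUT.LogVolume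

/-! ## 1. Print's image shape: pure tensors of SINGLE-PLACE vectors -/

namespace LogShells

variable {T : ThetaIndex} (L : LogShells T)

/-- **Single-place pure-tensor images** ([IUTchIII] Prop. 3.5 (ii) (a) p. 104 / (b) p. 105: "the image[s], via the
tensor product, over `|t| ∈ {0, …, j}`, of … the groups of units `(Ψ_cns(^{n,m}𝔉_≻)_{|t|})^×_v`, for `𝕍 ∋ v | v_ℚ`"):
the pure tensors `⊗_{|t|} x_{|t|}` of the `(j+1)`-packet at `v_ℚ` each of whose factors is supported at ONE place
`v | v_ℚ`, with its `v`-component in the given set `S_v`. [claim: Mochizuki2012, status: disputed] -/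
def tprodSingleImages (j : T.Label) (vQ : T.VQ) (S : ∀ v : T.Fibre vQ, Set (L.carrier v.1)) : Set (L.Packet j vQ) :=
  {t | ∃ x : T.Caps j → L.Packet1 vQ,
    (∀ i, ∃ v : T.Fibre vQ, (∀ v', v' ≠ v → x i v' = 0) ∧ x i v ∈ S v) ∧ t = L.tprod j vQ x}

/-- Monotone in the component sets. [folklore] -/
theorem tprodSingleImages_mono {j : T.Label} {vQ : T.VQ} {S S' : ∀ v : T.Fibre vQ, Set (L.carrier v.1)}
    (h : ∀ v, S v ⊆ S' v) : L.tprodSingleImages j vQ S ⊆ L.tprodSingleImages j vQ S' := by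
  rintro t ⟨x, hx, rfl⟩
  refine ⟨x, fun i => ?_, rfl⟩
  obtain ⟨v, h0, hv⟩ := hx i
  exact ⟨v, h0, h v hv⟩

/-- Single-place images lie in abc-iut-c312-12's all-places images of any family of supersets containing `0`
(the other components of a single-place vector vanish). [folklore] -/
theorem tprodSingleImages_subset_tprodImages {j : T.Label} {vQ : T.VQ}
    {S S' : ∀ v : T.Fibre vQ, Set (L.carrier v.1)} (h : ∀ v, S v ⊆ S' v) (h0 : ∀ v, (0 : L.carrier v.1) ∈ S' v) :
    L.tprodSingleImages j vQ S ⊆ L.tprodImages j vQ S' := by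
  rintro t ⟨x, hx, rfl⟩
  refine ⟨x, fun i v' => ?_, rfl⟩
  obtain ⟨v, hzero, hv⟩ := hx i
  by_cases hv' : v' = v
  · subst hv'; exact h _ hv
  · rw [hzero v' hv']; exact h0 v'

/-- **At a finite `v_ℚ`: single-place images of vectors in the shell subgroups lie in the integral structure
`I(^{S^±_{j+1}};𝒟^⊢_{v_ℚ}) = L.shellPk`** (c312-12's `tprodImages_subset_shellPk`). [folklore] -/
theorem tprodSingleImages_subset_shellPk {j : T.Label} {vQ : T.VQ} {S : ∀ v : T.Fibre vQ, Set (L.carrier v.1)}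
    (h : ∀ v, S v ⊆ L.shellSubgroup v.1) :
    L.tprodSingleImages j vQ S ⊆ (L.shellPk j vQ : Set (L.Packet j vQ)) :=
  (L.tprodSingleImages_subset_tprodImages (S' := fun v => (L.shellSubgroup v.1 : Set (L.carrier v.1))) h
    fun v => (L.shellSubgroup v.1).zero_mem).trans (L.tprodImages_subset_shellPk fun _ => subset_rfl)

/-- NON-VACUITY: a single-place image is inhabited as soon as one component set is. [folklore] -/
theorem tprodSingleImages_nonempty {j : T.Label} {vQ : T.VQ} {S : ∀ v : T.Fibre vQ, Set (L.carrier v.1)}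
    (h : ∃ v, (S v).Nonempty) : (L.tprodSingleImages j vQ S).Nonempty := by
  classical
  obtain ⟨v, a, ha⟩ := h
  refine ⟨L.tprod j vQ fun _ => Pi.single v a, fun _ => Pi.single v a, fun _ => ⟨v, fun v' hv' => ?_, ?_⟩, rfl⟩
  · exact Pi.single_eq_of_ne hv' _
  · simp only [Pi.single_eq_same]; exact ha

end LogShells

namespace Real

variable {F : Type} [Field F] [NumberField F]
variable (X : PilotData F) (logv : PadicLogs F) (Aut Ism : ∀ x : Place F, Set (Carrier x ≃ₗ[ℚ] Carrier x))
  (hAut : ∀ x, LinearEquiv.refl ℚ (Carrier x) ∈ Aut x) (hIsm : ∀ x, LinearEquiv.refl ℚ (Carrier x) ∈ Ism x)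

/-! ## 2. At `∞`: single-place images of shell vectors lie in print's Hermitian ball -/

/-- A shell vector at an archimedean place has `|·| ≤ π` in `ℂ` ([IUTchIII] Rmk. 1.2.2 (ii); `archEmb` is an
isometry). [claim: Mochizuki2012, status: disputed] -/
theorem norm_archEmb_le_pi_of_mem_shell :
    ∀ (w : ArchFibre X) {a : Carrier w.1}, a ∈ shell logv w.1 → ‖archEmb X w a‖ ≤ Real.pi
  | ⟨.inl w, _⟩, a, ha => by
    rw [norm_archEmb]
    rw [shell_inl] at ha
    exact ha
  | ⟨.inr _, h⟩, _, _ => absurd h (by simp [thetaIndex])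

variable [Fintype (ArchFibre X)]

/-- **PRINT'S (Ind3) AT `∞` for the single-place image shape**: single-place images with components in the
shells `𝓘_w = {|·| ≤ π}` lie in print's archimedean integral structure `𝓘(^{S^±_{j+1}}𝒟^⊢_∞)` (abc-iut-w4-d001's
`tprod_singlePlace_mem_archPkHermitian`). [claim: Mochizuki2012, status: disputed] -/
theorem tprodSingleImages_subset_archPkHermitian (j : (thetaIndex X).Label)
    {S : ∀ w : ArchFibre X, Set (Carrier w.1)} (hS : ∀ w, S w ⊆ shell logv w.1) :
    (logShells X logv Aut Ism hAut hIsm).tprodSingleImages j (infty X) S ⊆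
      archPkHermitian X logv Aut Ism hAut hIsm j := by
  classical
  rintro t ⟨x, hx, rfl⟩
  refine tprod_singlePlace_mem_archPkHermitian X logv Aut Ism hAut hIsm j x fun i => ?_
  obtain ⟨w, h0, hw⟩ := hx i
  exact ⟨w, h0, norm_archEmb_le_pi_of_mem_shell X logv w (hS w hw)⟩

/-- **The archimedean integral-structure binder SET TO PRINT's**: at `∞` the Hermitian ball `archPkHermitian`
([IUTchIII] Prop. 3.2 (ii) p. 98–99), at a prime anything (the binder is read only at `∞` by c312-5's
`MRData.ofShells`). [claim: Mochizuki2012, status: disputed] -/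
def archPkPrint : ∀ (j : (thetaIndex X).Label) (vQ : (thetaIndex X).VQ),
    Set ((logShells X logv Aut Ism hAut hIsm).Packet j vQ)
  | j, .inl _ => archPkHermitian X logv Aut Ism hAut hIsm j
  | _, .inr _ => Set.univ

/-- At `∞` the binder is print's Hermitian ball. [folklore] -/
theorem archPkPrint_infty (j : (thetaIndex X).Label) :
    archPkPrint X logv Aut Ism hAut hIsm j (infty X) = archPkHermitian X logv Aut Ism hAut hIsm j := rfl

/-! ## 3. The typed (Ind3) and (ii) for columns with print's single-place images and print's structure at `∞` -/

/-- **The typed (Ind3) HOLDS for single-place images against print's integral structures.** For a column over the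
real log-shells whose unit-group images are the single-place images of abc-iut-w4-d029's honest iterate images
(`Real.iterImage`: units for `m' = 0`, images of the `m'`-th iterate of the log-link for `m' ≥ 1`, at every
place) and whose radius-`π` balls are the single-place images of the shells, and coric data whose integral structure
contains `L.shellPk` at finite `v_ℚ` and print's `archPkHermitian` at `∞`: the containments of this seat's typed
`Column.Ind3` ([IUTchIII] Thm. 3.11 (ii) (Ind3) p. 156; Prop. 3.5 (ii) (a)(b) p. 104–105) hold — at finite `v_ℚ` by
`O_v^× ⊆ O_v ⊆ I_v` (the law) and `log^{m'}(…) ⊆ I_v`, at `∞` by `|u| = 1 ≤ π`, `|log(…)| ≤ π` and w4-d001's Hermitian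
computation. [claim: Mochizuki2012, status: disputed] -/
theorem _root_.Summit.ABC.IUTFork.Thm311.Column.ind3_of_singleImages (hlaw : LogvLaw logv)
    (C : Column (logShells X logv Aut Ism hAut hIsm)) (D : MRData (logShells X logv Aut Ism hAut hIsm))
    (hpk : ∀ (j : (thetaIndex X).Label) (vQ : (thetaIndex X).VQ), (thetaIndex X).IsNon vQ →
      ((logShells X logv Aut Ism hAut hIsm).shellPk j vQ :
        Set ((logShells X logv Aut Ism hAut hIsm).Packet j vQ)) ⊆ D.shellPk j vQ)
    (harch : ∀ j : (thetaIndex X).Label, archPkHermitian X logv Aut Ism hAut hIsm j ⊆ D.shellPk j (infty X))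
    (hunit : ∀ (m : ℤ) (m' : ℕ) (j : (thetaIndex X).Label) (vQ : (thetaIndex X).VQ),
      C.unitImage m m' j vQ =
        (logShells X logv Aut Ism hAut hIsm).tprodSingleImages j vQ fun v => iterImage logv m' v.1)
    (hball : ∀ (m : ℤ) (j : (thetaIndex X).Label) (vQ : (thetaIndex X).VQ),
      C.ballImage m j vQ =
        (logShells X logv Aut Ism hAut hIsm).tprodSingleImages j vQ fun v => shell logv v.1) :
    C.Ind3 D := by
  have hiter : ∀ (m' : ℕ) (x : Place F), iterImage logv m' x ⊆ shell logv x := fun m' x => by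
    rcases Nat.eq_zero_or_pos m' with rfl | hm'
    · rw [iterImage_zero]; exact unitsSet_subset_shell hlaw x
    · exact iterImage_subset_shell_of_one_le logv hm' x
  have hsub : ∀ (vQ : (thetaIndex X).VQ) (v : (thetaIndex X).Fibre vQ),
      (shell logv v.1 : Set ((logShells X logv Aut Ism hAut hIsm).carrier v.1)) ⊆
        ((logShells X logv Aut Ism hAut hIsm).shellSubgroup v.1 :
          Set ((logShells X logv Aut Ism hAut hIsm).carrier v.1)) :=
    fun vQ v => (logShells X logv Aut Ism hAut hIsm).shell_subset_shellSubgroup v.1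
  refine ⟨fun m m' j vQ hvQ => ?_, fun m j vQ hvQ => ?_⟩
  · rw [hunit]
    exact ((logShells X logv Aut Ism hAut hIsm).tprodSingleImages_subset_shellPk fun v =>
      (hiter m' v.1).trans (hsub vQ v)).trans (hpk j vQ hvQ)
  · rcases vQ with u | pp
    · rcases u
      refine ⟨?_, ?_, fun m' hm' => ?_⟩
      · rw [hunit]
        exact (tprodSingleImages_subset_archPkHermitian X logv Aut Ism hAut hIsm j fun w => hiter 0 w.1).trans
          (harch j)
      · rw [hball]
        exact (tprodSingleImages_subset_archPkHermitian X logv Aut Ism hAut hIsm j fun _ => subset_rfl).trans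
          (harch j)
      · rw [hunit, hball]
        exact (logShells X logv Aut Ism hAut hIsm).tprodSingleImages_mono fun v =>
          iterImage_subset_shell_of_one_le logv hm' v.1
    · exact absurd trivial hvQ

variable (archSub : ∀ (j : (thetaIndex X).Label) (v : Place F),
    Set ((logShells X logv Aut Ism hAut hIsm).Packet j ((thetaIndex X).over v)))
  (Adm : ∀ (j : (thetaIndex X).Label) (vQ : (thetaIndex X).VQ),
    Set ((logShells X logv Aut Ism hAut hIsm).Packet j vQ) → Prop)
  (logvol : ∀ (j : (thetaIndex X).Label) (vQ : (thetaIndex X).VQ),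
    Set ((logShells X logv Aut Ism hAut hIsm).Packet j vQ) → ℝ)
  (Ψ : ℤ → ∀ v : Place F, v ∈ (thetaIndex X).Vbad → Set ((logShells X logv Aut Ism hAut hIsm).StarPacket v))
  (act : ℤ → ∀ v : Place F, v ∈ (thetaIndex X).Vbad →
    (logShells X logv Aut Ism hAut hIsm).StarPacket v →
      Module.End ℚ ((logShells X logv Aut Ism hAut hIsm).StarPacket v))
  (Mmod : ℤ → ∀ j : (thetaIndex X).LabelStar, Set ((logShells X logv Aut Ism hAut hIsm).GlobalPacket j.1))
  (region : ℤ → ∀ j : (thetaIndex X).LabelStar, FinDivisor F → ∀ vQ : (thetaIndex X).VQ,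
    Set ((logShells X logv Aut Ism hAut hIsm).Packet j.1 vQ))
  (thetaDiv₀ : ℤ → ℤ → LgpDivisor F (thetaIndex X).lstar)

/-- **[IUTchIII] Thm. 3.11 (ii) AS TYPED for the strictified lattice situation over the real carriers WITH PRINT'S
ARCHIMEDEAN STRUCTURE and print's single-place (Ind3)-images** (c312-5's `LatticeSituation.ofShells` with
`archPk := archPkPrint`; the law `O_v ⊆ I_v` on the logarithm binder): `PartII` holds — by c312-5's
`partII_iff_ind3_of_coric` it is the (Ind3) of `Column.ind3_of_singleImages`. [claim: Mochizuki2012, status: disputed] -/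
theorem partII_ofShells_singleImages_print (hlaw : LogvLaw logv) :
    (LatticeSituation.ofShells (logShells X logv Aut Ism hAut hIsm) F (archPkPrint X logv Aut Ism hAut hIsm)
        archSub Adm logvol Ψ act Mmod region (fun _ _ => Adm) (fun _ _ => logvol) (fun n _ => Ψ n) (fun n _ => Mmod n)
        (fun _ _ m' j vQ =>
          (logShells X logv Aut Ism hAut hIsm).tprodSingleImages j vQ fun v => iterImage logv m' v.1)
        (fun _ _ j vQ => (logShells X logv Aut Ism hAut hIsm).tprodSingleImages j vQ fun v => shell logv v.1)
        thetaDiv₀).PartII := by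
  refine (LatticeSituation.partII_iff_ind3_of_coric (logShells X logv Aut Ism hAut hIsm) F
    (archPkPrint X logv Aut Ism hAut hIsm) archSub Adm logvol Ψ act Mmod region _ _ thetaDiv₀).mpr fun n => ?_
  refine Column.ind3_of_singleImages X logv Aut Ism hAut hIsm hlaw _ _ (fun j vQ hvQ => ?_) (fun j => ?_)
    (fun _ _ _ _ => rfl) (fun _ _ _ => rfl)
  · show _ ⊆ (MRData.ofShells (logShells X logv Aut Ism hAut hIsm) (archPkPrint X logv Aut Ism hAut hIsm) archSub
      Adm logvol (Ψ n) (act n) (Mmod n)).shellPk j vQ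
    rw [MRData.ofShells_shellPk_of_isNon _ _ archSub Adm logvol (Ψ n) (act n) (Mmod n) hvQ]
  · show _ ⊆ (MRData.ofShells (logShells X logv Aut Ism hAut hIsm) (archPkPrint X logv Aut Ism hAut hIsm) archSub
      Adm logvol (Ψ n) (act n) (Mmod n)).shellPk j (infty X)
    rw [MRData.ofShells_shellPk_of_not_isNon _ _ archSub Adm logvol (Ψ n) (act n) (Mmod n)
      (show ¬ (thetaIndex X).IsNon (infty X) from id)]
    exact subset_rfl

end Real

/-! ## 4. The whole typed Theorem 3.11 at the probability-weighted real instantiation with print's archimedean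
structure and print's (Ind3)-images -/

namespace Real

open CategoryTheory Cor312Vol

variable {F : Type} [Field F] [NumberField F] (X : PilotData F) [Fintype (ArchFibre X)]
  (archSub₀ : ∀ (j : (thetaIndex X).Label) (v : (thetaIndex X).V),
    Set ((logShellsDH X (analyticLogv F)).Packet j ((thetaIndex X).over v)))
  (act₀ : ∀ v : (thetaIndex X).V, v ∈ (thetaIndex X).Vbad →
    (logShellsDH X (analyticLogv F)).StarPacket v → Module.End ℚ ((logShellsDH X (analyticLogv F)).StarPacket v))
  (Mmod₀ : ∀ j : (thetaIndex X).LabelStar, Set ((logShellsDH X (analyticLogv F)).GlobalPacket j.1))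
  (region₀ : ℤ → ∀ j : (thetaIndex X).LabelStar, FinDivisor F → ∀ vQ : (thetaIndex X).VQ,
    Set ((logShellsDH X (analyticLogv F)).Packet j.1 vQ))
  (thetaDiv₀ : ℤ → ℤ → LgpDivisor F (thetaIndex X).lstar)
  {S : StripFrame.{0}} (G : LatticeGlue S) (Λ : LogThetaLatticeDiagram G.logData G.linkData)
  {Kap : Type} [Category.{0} Kap] (FM : Core S.DHT ⥤ Kap)

/-- **THE TYPED THEOREM 3.11 HOLDS OUTRIGHT at the probability-weighted real instantiation WITH PRINT'S
ARCHIMEDEAN INTEGRAL STRUCTURE and print's single-place (Ind3)-images.** As `Real.full_statement_Pr_LGP`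
(analytic logarithms; c312-5's `logShellsDH`; `𝕄(−)`/`μ^log` := `summandPiecesPr`; (b) := the LGP splitting monoid
for any `qroot`, `ζ`; (c) := fractional ideals with their direct product regions; coric strictified columns; any
Θ-pilot lgp-divisors; (iii)-objects over any L6 glue) EXCEPT: (a)'s archimedean integral structure := print's
Hermitian unit ball `archPkHermitian` (`archPkPrint`), the unit-group images and radius-`π` balls of (Ind3) :=
print's SINGLE-PLACE images `tprodSingleImages`. `Thm311.FullSituation.Statement` — no hypotheses. A measurement
of the typing; no side taken. [claim: Mochizuki2012, status: disputed] -/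
theorem full_statement_print_arch
    (qroot : ∀ v : HeightOneSpectrum (𝓞 F), Carrier (.inr v : Place F))
    (ζ : ∀ v : HeightOneSpectrum (𝓞 F), (thetaIndex X).LabelStar → (Carrier (.inr v : Place F))ˣ) :
    Summit.ABC.IUTFork.Thm311.FullSituation.Statement
      ({ LatticeSituation.ofShells (logShellsDH X (analyticLogv F)) F
            (archPkPrint X (analyticLogv F) stripAutDH (ismDH (analyticLogv F)) refl_mem_stripAutDH
              (refl_mem_ismDH (analyticLogv F)))
            archSub₀ (summandPiecesPr X (logvAnalytic_analyticLogv (F := F))).Adm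
            (summandPiecesPr X (logvAnalytic_analyticLogv (F := F))).logvol
            (fun _ x _ => match x with
              | .inr v => splittingMonoidLGP X (analyticLogv F) stripAutDH (ismDH (analyticLogv F))
                  refl_mem_stripAutDH (refl_mem_ismDH (analyticLogv F)) v (qroot v) (ζ v)
              | .inl _ => ∅)
            (fun _ => act₀) (fun _ => Mmod₀) region₀
            (fun _ _ => (summandPiecesPr X (logvAnalytic_analyticLogv (F := F))).Adm)
            (fun _ _ => (summandPiecesPr X (logvAnalytic_analyticLogv (F := F))).logvol)
            (fun _ _ x _ => match x with
              | .inr v => splittingMonoidLGP X (analyticLogv F) stripAutDH (ismDH (analyticLogv F))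
                  refl_mem_stripAutDH (refl_mem_ismDH (analyticLogv F)) v (qroot v) (ζ v)
              | .inl _ => ∅)
            (fun _ _ => Mmod₀)
            (fun _ _ m' j vQ =>
              (logShellsDH X (analyticLogv F)).tprodSingleImages j vQ fun v => iterImage (analyticLogv F) m' v.1)
            (fun _ _ j vQ =>
              (logShellsDH X (analyticLogv F)).tprodSingleImages j vQ fun v => shell (analyticLogv F) v.1)
            thetaDiv₀ with
          G := fun _ j => GlobalDegrees.ofIdeals (logShellsDH X (analyticLogv F)) F j
            (idealRegion X (logvAnalytic_analyticLogv (F := F)) j.1)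
          link := LinkData.ofGlueRadial G Λ FM } : FullSituation (thetaIndex X)) := by
  refine (FullSituation.statement_ofGlueRadial_iff_clauses
    ({ LatticeSituation.ofShells (logShellsDH X (analyticLogv F)) F
          (archPkPrint X (analyticLogv F) stripAutDH (ismDH (analyticLogv F)) refl_mem_stripAutDH
            (refl_mem_ismDH (analyticLogv F)))
          archSub₀ (summandPiecesPr X (logvAnalytic_analyticLogv (F := F))).Adm
          (summandPiecesPr X (logvAnalytic_analyticLogv (F := F))).logvol
          (fun _ x _ => match x with
            | .inr v => splittingMonoidLGP X (analyticLogv F) stripAutDH (ismDH (analyticLogv F))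
                refl_mem_stripAutDH (refl_mem_ismDH (analyticLogv F)) v (qroot v) (ζ v)
            | .inl _ => ∅)
          (fun _ => act₀) (fun _ => Mmod₀) region₀
          (fun _ _ => (summandPiecesPr X (logvAnalytic_analyticLogv (F := F))).Adm)
          (fun _ _ => (summandPiecesPr X (logvAnalytic_analyticLogv (F := F))).logvol)
          (fun _ _ x _ => match x with
            | .inr v => splittingMonoidLGP X (analyticLogv F) stripAutDH (ismDH (analyticLogv F))
                refl_mem_stripAutDH (refl_mem_ismDH (analyticLogv F)) v (qroot v) (ζ v)
            | .inl _ => ∅)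
          (fun _ _ => Mmod₀)
          (fun _ _ m' j vQ =>
            (logShellsDH X (analyticLogv F)).tprodSingleImages j vQ fun v => iterImage (analyticLogv F) m' v.1)
          (fun _ _ j vQ =>
            (logShellsDH X (analyticLogv F)).tprodSingleImages j vQ fun v => shell (analyticLogv F) v.1)
          thetaDiv₀ with
        G := fun _ j => GlobalDegrees.ofIdeals (logShellsDH X (analyticLogv F)) F j
          (idealRegion X (logvAnalytic_analyticLogv (F := F)) j.1) } : LatticeSituation (thetaIndex X))
    G Λ FM).mpr ⟨⟨?_, ?_, fun _ _ => rfl⟩, ?_⟩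
  · -- (i) (b): the LGP splitting monoids sit in the sub-packets (c312-5)
    exact fun _ => psiInSubPackets_ofShells_of_LGP X (analyticLogv F) stripAutDH (ismDH (analyticLogv F))
      refl_mem_stripAutDH (refl_mem_ismDH (analyticLogv F)) _ archSub₀ _ _ _ act₀ Mmod₀ qroot ζ fun _ _ => rfl
  · -- (i) (c): the degree clause (`Thm311RealDegreeFull`)
    exact degreeClause_situationPr X (logvAnalytic_analyticLogv (F := F)) _ archSub₀ _ (fun _ => act₀)
      (fun _ => Mmod₀) region₀
  · -- (ii): print's single-place images against print's structures, at the analytic logarithms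
    exact partII_ofShells_singleImages_print X (analyticLogv F) stripAutDH (ismDH (analyticLogv F))
      refl_mem_stripAutDH (refl_mem_ismDH (analyticLogv F)) archSub₀ _ _ _ (fun _ => act₀) (fun _ => Mmod₀)
      region₀ thetaDiv₀ (logvLaw_analyticLogv F)

end Real

end Summit.ABC.IUTFork.Thm311

end
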